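/-
Origin: expansion seat `planner-pub-hodgecm-mc-axioms-1-g14-0`, handover #W224 2026-08-20T15:53:55Z md5 36fd8e3bde17 (PKG f95aac57f121 → 36fd8e3bde17; 405 l.; MECHANICAL (iib-R) rewrite v3.1 of the PKG file as it stands (148 token edits; rules R1x1+RX[h₂]x147)) (`HOME/mc/pub-hodgecm-mc-axioms-1-g14/revendor/kit-r55/stage55/HodgeCM/Model/Binders/Gen12Junctions.lean`, md5 36fd8e3bde17, 405 lines);
landed by the gen-22 packager (p-g22) in gate run 55 REPLACES the earlier landed copy of `HodgeCM/Model/Binders/Gen12Junctions.lean` (seat copy carried the packager Origin header of an earlier run (stripped)).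
-/
/-
Origin: speedrun cell pub-hodgecm, MODEL-CONSTRUCTION sub-cell, unit pub-hodgecm-mc-binder-1-g6 (BINDER PROVER, gen 6; node
B2-meet = E binder `gen12`), seat prover-pub-hodgecm-mc-binder-1-g6-0, 2026-08-19.  ″ RE-CUT (adm) by the successor seat
prover-pub-hodgecm-mc-binder-1-g7-0 (unit pub-hodgecm-mc-binder-1-g7), 2026-08-19: the generating theta forms range over the
`K`-type situations satisfying an ADMISSIBILITY predicate (`thetaGen Γ k adm`; field `Gen12Junctions.Adm`) — at the (Θ-sat)
pin of RUN 37 `Adm Γ k Sit := Sit.IsSaturated (KΓ Γ) ∧ Sit.IsStrict` (theta-3 `Model/ThetaSpaceSat`), so that the see-saw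
junction only ever meets STRICT situations (BINDER-TRIAGE §63/§64); statements otherwise byte-identical.
Target in PKG: HodgeCM/Model/Binders/Gen12Junctions.lean (NEW additive leaf; imports `Model/E2InstanceR17A` (the pin) and
`Model/Binders/MeetBridgesSpan` (binder-1-g6 kit #1); nothing landed imports it).
KERNEL ONLY: every declaration below is proved; the junction statements are HYPOTHESES of the final theorems (fields of the
record `Gen12Junctions`), never asserted; 0 records of published theorems, nothing cited, MODEL-N 0.
-/
import Summits.HodgeConjecture.HodgeCM.Model.E2InstanceR17A
import Summits.HodgeConjecture.HodgeCM.Model.Binders.MeetBridgesSpan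

/-!
# The E binder `gen12` at the pin, REDUCED to named junction hypotheses

E's binder (revisions R15A / R17A)

  `gen12 : ∀ V c, GoodCtx → [c.K : ℚ] = 6 → Nonempty ((thetaModelOf … (wmOfInput W) (thetaOf _ (thetaClassInputOf _
     (thetaSpaceInputOf … S V c))) (d12Of μ) (d34Of μ)).Gen12FunBridge V c)`

is C5′ (`Gen12MeetAt`) by `Binders/MeetBridgesSpan.nonempty_gen12FunBridge_iff`, and C5′ follows from a SPAN bridge
(`Gen12SpanBridge`: the global (12)-wedge-function lies in the closed span of the theta lifts `ϑ₁₂(χ, Φ)` + piece projection).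
This file builds the span bridge AT THE PIN from junction hypotheses stated in the PIN'S OWN VOCABULARY — the record
`Gen12Junctions hHD hI h₁ h₃ h hA W S μ V c hV` — so that each producing lane sees the exact shape it must deliver:

* (J-rep)  [theta side: mc-theta-3 `thetaSpaceOf` / CLASSMAP `classMapDatumOf`]  every theta one-form `ω ∈ Θ_k(Γ)` (`k = 0, 1`)
  has an ADMISSIBLE adelic representative: a left-`Γ_U`-invariant function `G : G_U(𝔸) → ℂ²` with continuous coordinates,
  in the `ℂ`-span of the generating adelic theta forms of the pair `P k` at level `Γ`, restricting along `ιinf` to the pulled-back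
  class, and satisfying the saturation predicate `Sat Γ` of the record ((J-sat), BINDER-TRIAGE §54: intended value «right-invariant
  under emb's piece level `levelOf Γ` on the principal piece»);
* (J-seesaw)  [binder-1 tree #20–#27 + (S-restr) `P_eq_restrict` + [T]-currency + 𝒮^κ membership]  for every pair of GENERATING
  theta forms `θ₀ = θ(j₀, f₀)` of `P 0` and `θ₁ = θ(j₁, f₁)` of `P 1` (any `K`-type situations at level `Γ`), the realised global
  wedge-function `realise (θ₀ ∧ θ₁) ∈ L²([G_U])` is a FINITE linear combination of the model generators `(T.t12 V c).ϑ χ Φ`;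
* (J-Λ)  [emb lane: `embOf` = piece lift at `levelOf Γ`, `Junction/PieceUnfolding`]  for admissible representatives `G₁, G₂` of
  `ω₁, ω₂`: `Λ_Γ(ω₁, ω₂) = a • p`, `a ≠ 0`, `⟪p, realise (G₁ ∧ G₂)⟫ = ⟪p, p⟫` (the input shape of `Gen12FunBridge.proj_of_eq_smul`).

MAIN RESULTS: `gen12SpanBridgeOfJunctions` (the span bridge), `nonempty_gen12FunBridge_of_junctions` (E's binder at `(V, c)`),
`gen12_of_junctions` (E's binder in its quantified form, the regime `hV` coming from `isAnisotropic_of_goodCtx`).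
Everything else is linear algebra: the global wedge `wedge₂` is bilinear, `realise = toLp ∘ (descend along g ↦ g⁻¹)` is linear,
spans are carried by `Submodule.map₂_span_span`.
-/

set_option autoImplicit false

noncomputable section

open scoped InnerProductSpace
open MeasureTheory

namespace HodgeCM

/-! ## 1. Realising global left-invariant functions in `L²(G ⧸ Γ)` -/

namespace QuotientModel

variable (Q : QuotientModel)

/-- Left-`Γ`-invariant continuous functions `G → ℂ` (global automorphic functions, read on the group). -/
def leftInvCont : Submodule ℂ (Q.G → ℂ) where
  carrier := {φ | (∀ γ ∈ Q.Γ, ∀ g : Q.G, φ (γ * g) = φ g) ∧ Continuous φ}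
  zero_mem' := ⟨fun _ _ _ => rfl, continuous_const⟩
  add_mem' {φ ψ} hφ hψ := ⟨fun γ hγ g => by simp only [Pi.add_apply, hφ.1 γ hγ g, hψ.1 γ hγ g], hφ.2.add hψ.2⟩
  smul_mem' a φ hφ := ⟨fun γ hγ g => by simp only [Pi.smul_apply, hφ.1 γ hγ g], continuous_const.smul hφ.2⟩

/-- (Ported verbatim from the HodgeCMPerL package; no docstring in the source.) -/
theorem mem_leftInvCont_iff (φ : Q.G → ℂ) :
    φ ∈ Q.leftInvCont ↔ (∀ γ ∈ Q.Γ, ∀ g : Q.G, φ (γ * g) = φ g) ∧ Continuous φ := Iff.rfl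

/-- A left-invariant function read on `G ⧸ Γ` through `g ↦ g⁻¹`: `descendInv φ (gΓ) = φ g⁻¹` (well defined: `(g γ)⁻¹ = γ⁻¹ g⁻¹`). -/
def descendInvFun (φ : Q.G → ℂ) (hφ : ∀ γ ∈ Q.Γ, ∀ g : Q.G, φ (γ * g) = φ g) : Q.G ⧸ Q.Γ → ℂ :=
  fun q => Quotient.liftOn' q (fun g => φ g⁻¹) fun a b hab => by
    have h : a⁻¹ * b ∈ Q.Γ := QuotientGroup.leftRel_apply.mp hab
    have hb : b⁻¹ = (a⁻¹ * b)⁻¹ * a⁻¹ := by group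
    show φ a⁻¹ = φ b⁻¹
    rw [hb, hφ _ (Q.Γ.inv_mem h)]

/-- (Ported verbatim from the HodgeCMPerL package; no docstring in the source.) -/
theorem descendInvFun_mk (φ : Q.G → ℂ) (hφ : ∀ γ ∈ Q.Γ, ∀ g : Q.G, φ (γ * g) = φ g) (g : Q.G) :
    Q.descendInvFun φ hφ (QuotientGroup.mk g) = φ g⁻¹ := rfl

/-- (Ported verbatim from the HodgeCMPerL package; no docstring in the source.) -/
theorem continuous_descendInvFun (φ : Q.G → ℂ) (hφ : ∀ γ ∈ Q.Γ, ∀ g : Q.G, φ (γ * g) = φ g) (hc : Continuous φ) :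
    Continuous (Q.descendInvFun φ hφ) :=
  (hc.comp continuous_inv).quotient_liftOn' _

/-- **The realisation map** `leftInvCont →ₗ[ℂ] L²(G ⧸ Γ, ν)`: descend along `g ↦ g⁻¹` to a continuous function on the compact
quotient, then `ContinuousMap.toLp` (the kernel-model inclusion `C([G_U]) → L²([G_U])`). -/
def realise : Q.leftInvCont →ₗ[ℂ] Q.H where
  toFun φ := ContinuousMap.toLp (E := ℂ) 2 Q.ν ℂ
    ⟨Q.descendInvFun φ.1 φ.2.1, Q.continuous_descendInvFun φ.1 φ.2.1 φ.2.2⟩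
  map_add' φ ψ := by
    rw [← map_add]
    congr 1
    ext q
    induction q using QuotientGroup.induction_on with
    | H g => rfl
  map_smul' a φ := by
    rw [RingHom.id_apply, ← map_smul]
    congr 1
    ext q
    induction q using QuotientGroup.induction_on with
    | H g => rfl

/-- The continuous function underlying `realise φ`. -/
def descendInv (φ : Q.leftInvCont) : C(Q.G ⧸ Q.Γ, ℂ) :=
  ⟨Q.descendInvFun φ.1 φ.2.1, Q.continuous_descendInvFun φ.1 φ.2.1 φ.2.2⟩

/-- (Ported verbatim from the HodgeCMPerL package; no docstring in the source.) -/
@[simp] theorem descendInv_mk (φ : Q.leftInvCont) (g : Q.G) : Q.descendInv φ (QuotientGroup.mk g) = φ.1 g⁻¹ := rfl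

/-- (Ported verbatim from the HodgeCMPerL package; no docstring in the source.) -/
theorem realise_apply (φ : Q.leftInvCont) : Q.realise φ = ContinuousMap.toLp (E := ℂ) 2 Q.ν ℂ (Q.descendInv φ) := rfl

/-! ### The global wedge of two `ℂ²`-valued functions -/

/-- Left-`Γ`-invariant `ℂ²`-valued functions with continuous coordinates (adelic one-forms read on the group). -/
def leftInvCont₂ : Submodule ℂ (Q.G → (Fin 2 → ℂ)) where
  carrier := {F | (∀ γ ∈ Q.Γ, ∀ g : Q.G, F (γ * g) = F g) ∧ ∀ i : Fin 2, Continuous fun g => F g i}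
  zero_mem' := ⟨fun _ _ _ => rfl, fun _ => continuous_const⟩
  add_mem' {F F'} hF hF' := ⟨fun γ hγ g => by simp only [Pi.add_apply, hF.1 γ hγ g, hF'.1 γ hγ g],
    fun i => by
      have h := (hF.2 i).add (hF'.2 i)
      exact h⟩
  smul_mem' a F hF := ⟨fun γ hγ g => by simp only [Pi.smul_apply, hF.1 γ hγ g],
    fun i => by
      have h := (continuous_const (y := a)).mul (hF.2 i)
      exact h⟩

/-- (Ported verbatim from the HodgeCMPerL package; no docstring in the source.) -/
theorem mem_leftInvCont₂_iff (F : Q.G → (Fin 2 → ℂ)) :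
    F ∈ Q.leftInvCont₂ ↔ (∀ γ ∈ Q.Γ, ∀ g : Q.G, F (γ * g) = F g) ∧ ∀ i : Fin 2, Continuous fun g => F g i := Iff.rfl

/-- The global wedge-function `(F ∧ F')(g) = F(g)₀ F'(g)₁ − F(g)₁ F'(g)₀` (PerL (eq:Qaut) l. 249 «u₁ ∧ u₂ = u₁¹u₂² − u₁²u₂¹»;
the tree's `Weil1964.wedgeFun` at the two coordinate functionals of `ℂ²`). -/
def wedge₂Fun (F F' : Q.G → (Fin 2 → ℂ)) : Q.G → ℂ := fun g => F g 0 * F' g 1 - F g 1 * F' g 0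

/-- (Ported verbatim from the HodgeCMPerL package; no docstring in the source.) -/
@[simp] theorem wedge₂Fun_apply (F F' : Q.G → (Fin 2 → ℂ)) (g : Q.G) :
    Q.wedge₂Fun F F' g = F g 0 * F' g 1 - F g 1 * F' g 0 := rfl

/-- (Ported verbatim from the HodgeCMPerL package; no docstring in the source.) -/
theorem wedge₂Fun_mem (F F' : Q.leftInvCont₂) : Q.wedge₂Fun F.1 F'.1 ∈ Q.leftInvCont := by
  refine ⟨fun γ hγ g => ?_, ?_⟩
  · simp only [wedge₂Fun_apply, F.2.1 γ hγ g, F'.2.1 γ hγ g]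
  · exact ((F.2.2 0).mul (F'.2.2 1)).sub ((F.2.2 1).mul (F'.2.2 0))

/-- **The global wedge as a BILINEAR map** `leftInvCont₂ →ₗ leftInvCont₂ →ₗ leftInvCont`. -/
def wedge₂ : Q.leftInvCont₂ →ₗ[ℂ] Q.leftInvCont₂ →ₗ[ℂ] Q.leftInvCont :=
  LinearMap.mk₂ ℂ (fun F F' => ⟨Q.wedge₂Fun F.1 F'.1, Q.wedge₂Fun_mem F F'⟩)
    (fun F₁ F₂ F' => by ext g; simp only [Submodule.coe_add, wedge₂Fun_apply, Pi.add_apply]; ring)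
    (fun a F F' => by ext g; simp only [Submodule.coe_smul, wedge₂Fun_apply, Pi.smul_apply, smul_eq_mul]; ring)
    (fun F F₁' F₂' => by ext g; simp only [Submodule.coe_add, wedge₂Fun_apply, Pi.add_apply]; ring)
    (fun a F F' => by ext g; simp only [Submodule.coe_smul, wedge₂Fun_apply, Pi.smul_apply, smul_eq_mul]; ring)

/-- (Ported verbatim from the HodgeCMPerL package; no docstring in the source.) -/
@[simp] theorem coe_wedge₂ (F F' : Q.leftInvCont₂) : (Q.wedge₂ F F' : Q.G → ℂ) = Q.wedge₂Fun F.1 F'.1 := rfl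

/-- **Span transport**: if the realised wedges of all pairs of generators `F ∈ A`, `F' ∈ B` lie in a submodule `M` of `L²`, so do
the realised wedges of all pairs from the spans (`Submodule.map₂_span_span`). -/
theorem realise_wedge₂_mem_of_span {A B : Set Q.leftInvCont₂} {M : Submodule ℂ Q.H}
    (h : ∀ F ∈ A, ∀ F' ∈ B, Q.realise (Q.wedge₂ F F') ∈ M) {F F' : Q.leftInvCont₂} (hF : F ∈ Submodule.span ℂ A)
    (hF' : F' ∈ Submodule.span ℂ B) : Q.realise (Q.wedge₂ F F') ∈ M := by
  have hle : (Submodule.map₂ Q.wedge₂ (Submodule.span ℂ A) (Submodule.span ℂ B)).map Q.realise ≤ M := by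
    rw [Submodule.map₂_span_span, Submodule.map_span, Submodule.span_le]
    rintro _ ⟨_, ⟨F, hF, F', hF', rfl⟩, rfl⟩
    exact h F hF F' hF'
  exact hle (Submodule.mem_map_of_mem (Submodule.apply_mem_map₂ Q.wedge₂ hF hF'))

end QuotientModel

/-! ## 2. The junction record at the pin and the span bridge -/

namespace Model

open HodgeCM.Universe (AdelicThetaCore AdelicThetaCore₀ SideData ThetaModel)
open Literature.AlgebraicGeometry.HodgeTheory
open Literature.NumberTheory.Automorphic.PicardCM
open Literature.NumberTheory.Transcendental (Arapura2012_Cor_15_4_6)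
open Literature.NumberTheory.Automorphic Literature.NumberTheory.Weil1964
open Literature.NumberTheory.Automorphic.WeightForms (ClassMapDatum thetaClasses restrictHom IsLevelCorrected IsWeightMatched)
open HodgeCM.Model.ThetaSpace
open NumberField

variable (hHD : exists_isReal_hodgeModel) (hI : hodgePQ_independent_of_hodgeModel)
  (h₁ : BallQuotientUniformised)  (h₃ : CMAbelianVarietyRealised)
variable (h : Bool) (hA : Arapura2012_Cor_15_4_6)
  (W : ∀ {L : CMField} {ι₁ : L →+* ℂ} (V : HermSpace3 L ι₁) (c : SeesawCtx L), WmInput V c.D)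
  (S : ∀ {L : CMField} {ι₁ : L →+* ℂ} (V : HermSpace3 L ι₁) (c : SeesawCtx L), ThetaAdelicSide V c)
  (μ : ∀ {L : CMField}, SeesawCtx L → Fin 4 → InfinitePlace L → ℤ)

/-- **The pinned END-STATE theta model of E** (`Model.perL_picardCM_r15A` / `_r17A`): `thetaModelOf` at
`emb := embOf`, `cover := coverOf hA`, `wm := wmOfInput W`, `Theta := thetaOf _ (thetaClassInputOf _ (thetaSpaceInputOf … S))`,
`d12Of μ`, `d34Of μ` (a reducible name; no content). -/
abbrev pinT : (picardCMUniverse hHD hI h₁ h₃).ThetaModel :=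
  thetaModelOf hHD hI h₁ h₃ h (embOf hHD hI h₁ h₃) (coverOf hHD hI h₁ h₃ hA) (wmOfInput W)
    (thetaOf _ (thetaClassInputOf _ (fun V c => thetaSpaceInputOf hHD hI h₁ h₃ S V c))) (d12Of μ) (d34Of μ)

variable {L : CMField} {ι₁ : L →+* ℂ} (V : HermSpace3 L ι₁) (c : SeesawCtx L) (hV : IsAnisotropic L V.Hm)

/-- The quotient model of `[G_U]` in which E's `emb` and the theta lifts live (`T.HG L ι₁ V = Q.H`, `rfl`). -/
abbrev quotU : QuotientModel := (V.latticeModel printFact_unitaryCompact_holds).toQuotientModel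

/-- The pinned theta-space input of the context IN THE REGIME (`Model/ThetaSpaceInputPin`). -/
abbrev pinX : ThetaSpaceInput (picardCMUniverse hHD hI h₁ h₃) V c :=
  thetaSpaceInputIn hHD hI h₁ h₃ (S V c) hV

/-- **The generating adelic theta forms of type index `k` at level `Γ`**, read as left-invariant `ℂ²`-valued functions on
`G_U(𝔸)`: the theta forms `θ(j, f)` of the pair datum `(S V c).P k` over all ADMISSIBLE (`adm`) `K`-type situations at level `Γ`, all test families
`j` of the situation and all weight functions `f` of the pair (the generators of mc-theta-3's `thetaSpaceOf`, BEFORE restriction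
along `ιinf`). -/
def thetaGen (Γ : Level V) (k : Fin 4)
    (adm : KTypeSituation ((pinX hHD hI h₁ h₃ S V c hV).P k) ((pinX hHD hI h₁ h₃ S V c hV).ιinf Γ)
      ((pinX hHD hI h₁ h₃ S V c hV).Δ Γ) (pinX hHD hI h₁ h₃ S V c hV).κ₁ (pinX hHD hI h₁ h₃ S V c hV).τ₁ → Prop) :
    Set (quotU V).leftInvCont₂ :=
  {F | ∃ (Sit : KTypeSituation ((pinX hHD hI h₁ h₃ S V c hV).P k) ((pinX hHD hI h₁ h₃ S V c hV).ιinf Γ)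
      ((pinX hHD hI h₁ h₃ S V c hV).Δ Γ) (pinX hHD hI h₁ h₃ S V c hV).κ₁ (pinX hHD hI h₁ h₃ S V c hV).τ₁),
    adm Sit ∧ ∃ j ∈ Sit.𝓙, ∃ f ∈ ((pinX hHD hI h₁ h₃ S V c hV).P k).weightFunctions,
      (F : (quotU V).G → (Fin 2 → ℂ)) =
        (((pinX hHD hI h₁ h₃ S V c hV).P k).kernelDatum.thetaForm
          (Literature.NumberTheory.Automorphic.probHaarRelNormOneQuot (pinX hHD hI h₁ h₃ S V c hV).K (pinX hHD hI h₁ h₃ S V c hV).L)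
          ((pinX hHD hI h₁ h₃ S V c hV).P k).kernelDatum_thetaLinear Sit.κ j.1 j.2 Sit.ι Sit.hι f).1}

/-- **The generating theta forms ARE admissible candidates**: each `θ(j, f)` of a situation at level `Γ` is left-`Γ_U`-invariant
(its `weightForms` membership, read through `(S V c).hΓU k`) with continuous coordinates (tree `continuous_apply_thetaForm` at the two
coordinate functionals) — so `thetaGen Γ k` consists of honest elements of `leftInvCont₂`. -/
theorem coe_thetaForm_mem_leftInvCont₂ (Γ : Level V) (k : Fin 4)
    (Sit : KTypeSituation ((pinX hHD hI h₁ h₃ S V c hV).P k) ((pinX hHD hI h₁ h₃ S V c hV).ιinf Γ)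
      ((pinX hHD hI h₁ h₃ S V c hV).Δ Γ) (pinX hHD hI h₁ h₃ S V c hV).κ₁ (pinX hHD hI h₁ h₃ S V c hV).τ₁)
    (j : {j : Sit.E →ₗ[ℂ] ((pinX hHD hI h₁ h₃ S V c hV).P k).weilDatum.ThetaTop //
      ((pinX hHD hI h₁ h₃ S V c hV).P k).kernelDatum.IsThetaEquivariant Sit.κ Sit.σ j})
    (f : C(Literature.NumberTheory.Automorphic.relNormOneIdeles (pinX hHD hI h₁ h₃ S V c hV).K (pinX hHD hI h₁ h₃ S V c hV).L ⧸
      Literature.NumberTheory.Automorphic.relNormOneRat (pinX hHD hI h₁ h₃ S V c hV).K (pinX hHD hI h₁ h₃ S V c hV).L, ℂ)) :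
    ((((pinX hHD hI h₁ h₃ S V c hV).P k).kernelDatum.thetaForm
          (Literature.NumberTheory.Automorphic.probHaarRelNormOneQuot (pinX hHD hI h₁ h₃ S V c hV).K
            (pinX hHD hI h₁ h₃ S V c hV).L)
          ((pinX hHD hI h₁ h₃ S V c hV).P k).kernelDatum_thetaLinear Sit.κ j.1 j.2 Sit.ι Sit.hι f).1 :
        (quotU V).G → (Fin 2 → ℂ)) ∈ (quotU V).leftInvCont₂ := by
  set θ := ((pinX hHD hI h₁ h₃ S V c hV).P k).kernelDatum.thetaForm
    (Literature.NumberTheory.Automorphic.probHaarRelNormOneQuot (pinX hHD hI h₁ h₃ S V c hV).K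
      (pinX hHD hI h₁ h₃ S V c hV).L)
    ((pinX hHD hI h₁ h₃ S V c hV).P k).kernelDatum_thetaLinear Sit.κ j.1 j.2 Sit.ι Sit.hι f with hθ
  refine ⟨fun γ hγ g => ?_, fun i => ?_⟩
  · have hΓ : γ ∈ ((pinX hHD hI h₁ h₃ S V c hV).P k).ΓU := by
      rw [show ((pinX hHD hI h₁ h₃ S V c hV).P k).ΓU = (V.latticeModel printFact_unitaryCompact_holds).Γ from
        (S V c).hΓU k]
      exact hγ
    exact θ.2.1 γ hΓ g
  · exact ((pinX hHD hI h₁ h₃ S V c hV).P k).kernelDatum.continuous_apply_thetaForm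
      (Literature.NumberTheory.Automorphic.probHaarRelNormOneQuot (pinX hHD hI h₁ h₃ S V c hV).K
        (pinX hHD hI h₁ h₃ S V c hV).L)
      ((pinX hHD hI h₁ h₃ S V c hV).P k).kernelDatum_thetaLinear Sit.κ j.1 j.2 Sit.ι Sit.hι f (LinearMap.proj i)

/-- The generating theta form as an element of `leftInvCont₂` … -/
def thetaGenElt (Γ : Level V) (k : Fin 4)
    (Sit : KTypeSituation ((pinX hHD hI h₁ h₃ S V c hV).P k) ((pinX hHD hI h₁ h₃ S V c hV).ιinf Γ)
      ((pinX hHD hI h₁ h₃ S V c hV).Δ Γ) (pinX hHD hI h₁ h₃ S V c hV).κ₁ (pinX hHD hI h₁ h₃ S V c hV).τ₁)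
    (j : {j : Sit.E →ₗ[ℂ] ((pinX hHD hI h₁ h₃ S V c hV).P k).weilDatum.ThetaTop //
      ((pinX hHD hI h₁ h₃ S V c hV).P k).kernelDatum.IsThetaEquivariant Sit.κ Sit.σ j})
    (f : C(Literature.NumberTheory.Automorphic.relNormOneIdeles (pinX hHD hI h₁ h₃ S V c hV).K (pinX hHD hI h₁ h₃ S V c hV).L ⧸
      Literature.NumberTheory.Automorphic.relNormOneRat (pinX hHD hI h₁ h₃ S V c hV).K (pinX hHD hI h₁ h₃ S V c hV).L, ℂ)) :
    (quotU V).leftInvCont₂ :=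
  ⟨_, coe_thetaForm_mem_leftInvCont₂ hHD hI h₁ h₃ S V c hV Γ k Sit j f⟩

/-- … and it lies in `thetaGen Γ k adm` whenever `Sit` is admissible, `j ∈ Sit.𝓙` and `f` is a weight function of the pair. -/
theorem thetaGenElt_mem (Γ : Level V) (k : Fin 4)
    (Sit : KTypeSituation ((pinX hHD hI h₁ h₃ S V c hV).P k) ((pinX hHD hI h₁ h₃ S V c hV).ιinf Γ)
      ((pinX hHD hI h₁ h₃ S V c hV).Δ Γ) (pinX hHD hI h₁ h₃ S V c hV).κ₁ (pinX hHD hI h₁ h₃ S V c hV).τ₁)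
    {j : {j : Sit.E →ₗ[ℂ] ((pinX hHD hI h₁ h₃ S V c hV).P k).weilDatum.ThetaTop //
      ((pinX hHD hI h₁ h₃ S V c hV).P k).kernelDatum.IsThetaEquivariant Sit.κ Sit.σ j}} (hj : j ∈ Sit.𝓙)
    {f : C(Literature.NumberTheory.Automorphic.relNormOneIdeles (pinX hHD hI h₁ h₃ S V c hV).K (pinX hHD hI h₁ h₃ S V c hV).L ⧸
      Literature.NumberTheory.Automorphic.relNormOneRat (pinX hHD hI h₁ h₃ S V c hV).K (pinX hHD hI h₁ h₃ S V c hV).L, ℂ)}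
    (hf : f ∈ ((pinX hHD hI h₁ h₃ S V c hV).P k).weightFunctions)
    {adm : KTypeSituation ((pinX hHD hI h₁ h₃ S V c hV).P k) ((pinX hHD hI h₁ h₃ S V c hV).ιinf Γ)
      ((pinX hHD hI h₁ h₃ S V c hV).Δ Γ) (pinX hHD hI h₁ h₃ S V c hV).κ₁ (pinX hHD hI h₁ h₃ S V c hV).τ₁ → Prop}
    (hadm : adm Sit) :
    thetaGenElt hHD hI h₁ h₃ S V c hV Γ k Sit j f ∈ thetaGen hHD hI h₁ h₃ S V c hV Γ k adm :=
  ⟨Sit, hadm, j, hj, f, hf, rfl⟩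

/-- **The junction hypotheses for E's binder `gen12` at the context `(V, c)`** (regime `hV`).  `Sat Γ` is the saturation
predicate of (J-sat) (intended value, emb lane: «right-invariant under `levelOf Γ` on the principal piece»); the three `Prop`
fields are the junctions (J-rep), (J-seesaw), (J-Λ) of the module docstring, each typed at the strength its producer exports.
Nothing here is asserted: the record is a HYPOTHESIS of the theorems below. -/
structure Gen12Junctions where
  /-- (J-adm) the ADMISSIBILITY predicate on `K`-type situations whose theta forms generate (at the (Θ-sat) pin: saturated at the
  level's compact open AND strict) -/
  Adm : ∀ (Γ : Level V) (k : Fin 4),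
    KTypeSituation ((pinX hHD hI h₁ h₃ S V c hV).P k) ((pinX hHD hI h₁ h₃ S V c hV).ιinf Γ)
      ((pinX hHD hI h₁ h₃ S V c hV).Δ Γ) (pinX hHD hI h₁ h₃ S V c hV).κ₁ (pinX hHD hI h₁ h₃ S V c hV).τ₁ → Prop
  /-- (J-sat) the saturation predicate on adelic representatives, per level -/
  Sat : Level V → (quotU V).leftInvCont₂ → Prop
  /-- (J-rep) every theta one-form of type `0` or `1` has an admissible adelic representative in the span of the generating theta
  forms: a class-map preimage `cl` with `↑cl = ω`, and `G` left-invariant with continuous coordinates, saturated, restricting along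
  `ιinf` to the pulled-back classical form `pull cl` -/
  rep : ∀ (Γ : Level V) (k : Fin 4), k = 0 ∨ k = 1 →
    ∀ ω ∈ (pinT hHD hI h₁ h₃ h hA W S μ).Theta V c k Γ,
      ∃ (cl : ((pinX hHD hI h₁ h₃ S V c hV).D Γ).H10) (G : (quotU V).leftInvCont₂),
        (cl : (picardCMUniverse hHD hI h₁ h₃).CohC ((picardCMUniverse hHD hI h₁ h₃).pms L ι₁ V Γ) 1) = ω ∧
        G ∈ Submodule.span ℂ (thetaGen hHD hI h₁ h₃ S V c hV Γ k (Adm Γ k)) ∧ Sat Γ G ∧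
        ((((pinX hHD hI h₁ h₃ S V c hV).D Γ).pull cl).1 : (pinX hHD hI h₁ h₃ S V c hV).G₁ → (Fin 2 → ℂ)) =
          (G : (quotU V).G → (Fin 2 → ℂ)) ∘ ((pinX hHD hI h₁ h₃ S V c hV).ιinf Γ)
  /-- (J-seesaw) for every pair of GENERATING theta forms the realised global wedge-function is a finite linear combination of
  the (12)-theta lifts of the model (PerL (eq:seesaw) + (eq:Qaut), in the model's currency) -/
  seesaw : ∀ (Γ : Level V), ∀ F ∈ thetaGen hHD hI h₁ h₃ S V c hV Γ 0 (Adm Γ 0), ∀ F' ∈ thetaGen hHD hI h₁ h₃ S V c hV Γ 1 (Adm Γ 1),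
    ((quotU V).realise ((quotU V).wedge₂ F F') : (pinT hHD hI h₁ h₃ h hA W S μ).HG L ι₁ V) ∈
      Submodule.span ℂ ((pinT hHD hI h₁ h₃ h hA W S μ).gen12Set V c)
  /-- (J-Λ) PIECE PROJECTION for saturated representatives: `Λ_Γ(cl₁, cl₂) = a • p`, `a ≠ 0`, `⟪p, realise (G₁ ∧ G₂)⟫ = ⟪p, p⟫` -/
  proj : ∀ (Γ : Level V) (cl₁ cl₂ : ((pinX hHD hI h₁ h₃ S V c hV).D Γ).H10) (G₁ G₂ : (quotU V).leftInvCont₂),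
    Sat Γ G₁ → Sat Γ G₂ →
    ((((pinX hHD hI h₁ h₃ S V c hV).D Γ).pull cl₁).1 : (pinX hHD hI h₁ h₃ S V c hV).G₁ → (Fin 2 → ℂ)) =
      (G₁ : (quotU V).G → (Fin 2 → ℂ)) ∘ ((pinX hHD hI h₁ h₃ S V c hV).ιinf Γ) →
    ((((pinX hHD hI h₁ h₃ S V c hV).D Γ).pull cl₂).1 : (pinX hHD hI h₁ h₃ S V c hV).G₁ → (Fin 2 → ℂ)) =
      (G₂ : (quotU V).G → (Fin 2 → ℂ)) ∘ ((pinX hHD hI h₁ h₃ S V c hV).ιinf Γ) →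
    ∃ (a : ℂ) (p : (pinT hHD hI h₁ h₃ h hA W S μ).HG L ι₁ V), a ≠ 0 ∧
      (pinT hHD hI h₁ h₃ h hA W S μ).Λ Γ
          (cl₁ : (picardCMUniverse hHD hI h₁ h₃).CohC ((picardCMUniverse hHD hI h₁ h₃).pms L ι₁ V Γ) 1)
          (cl₂ : (picardCMUniverse hHD hI h₁ h₃).CohC ((picardCMUniverse hHD hI h₁ h₃).pms L ι₁ V Γ) 1) = a • p ∧
      ⟪p, (quotU V).realise ((quotU V).wedge₂ G₁ G₂)⟫_ℂ = ⟪p, p⟫_ℂ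


namespace Gen12Junctions

variable {hHD hI h₁ h₃ h hA W S μ V c hV}
variable (J : Gen12Junctions hHD hI h₁ h₃ h hA W S μ V c hV)

/-- At the pin, in the regime, `Θ_k(Γ)` IS the theta-class set of the regime input (`dif_pos`). -/
theorem theta_eq (k : Fin 4) (Γ : Level V) :
    (pinT hHD hI h₁ h₃ h hA W S μ).Theta V c k Γ =
      thetaClasses (MonoidHom.id _) ((pinX hHD hI h₁ h₃ S V c hV).D Γ) ((pinX hHD hI h₁ h₃ S V c hV).Θ k Γ) :=
  thetaOf_thetaSpaceInputOf_of_isAnisotropic hHD hI h₁ h₃ S V c k Γ hV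

/-- **The global wedge-function of two theta one-forms, realised in `L²([G_U])`** (the value of `wf`): for `ω₁ ∈ Θ₀(Γ)`,
`ω₂ ∈ Θ₁(Γ)` the realised wedge `realise (G₁ ∧ G₂)` of the admissible representatives CHOSEN by (J-rep); `0` otherwise. -/
def wf (Γ : Level V) (ω₁ ω₂ : (picardCMUniverse hHD hI h₁ h₃).CohC ((picardCMUniverse hHD hI h₁ h₃).pms L ι₁ V Γ) 1) :
    (pinT hHD hI h₁ h₃ h hA W S μ).HG L ι₁ V := by
  classical
  exact if hω : ω₁ ∈ (pinT hHD hI h₁ h₃ h hA W S μ).Theta V c 0 Γ ∧ ω₂ ∈ (pinT hHD hI h₁ h₃ h hA W S μ).Theta V c 1 Γ then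
      (quotU V).realise ((quotU V).wedge₂ (J.rep Γ 0 (Or.inl rfl) ω₁ hω.1).choose_spec.choose
        (J.rep Γ 1 (Or.inr rfl) ω₂ hω.2).choose_spec.choose)
    else 0

/-- (Ported verbatim from the HodgeCMPerL package; no docstring in the source.) -/
theorem wf_of_mem (Γ : Level V) {ω₁ ω₂ : (picardCMUniverse hHD hI h₁ h₃).CohC ((picardCMUniverse hHD hI h₁ h₃).pms L ι₁ V Γ) 1}
    (h₀ : ω₁ ∈ (pinT hHD hI h₁ h₃ h hA W S μ).Theta V c 0 Γ) (h₁' : ω₂ ∈ (pinT hHD hI h₁ h₃ h hA W S μ).Theta V c 1 Γ) :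
    J.wf Γ ω₁ ω₂ =
      (quotU V).realise ((quotU V).wedge₂ (J.rep Γ 0 (Or.inl rfl) ω₁ h₀).choose_spec.choose
        (J.rep Γ 1 (Or.inr rfl) ω₂ h₁').choose_spec.choose) := by
  classical
  exact dif_pos (And.intro h₀ h₁')

/-- **`wf_mem` from (J-rep) + (J-seesaw)**: the representatives lie in the spans of the generating theta forms, the realised wedge of
generators is a finite combination of lifts, and `realise ∘ wedge₂` is bilinear (`realise_wedge₂_mem_of_span`). -/
theorem wf_mem (Γ : Level V) (ω₁ ω₂ : (picardCMUniverse hHD hI h₁ h₃).CohC ((picardCMUniverse hHD hI h₁ h₃).pms L ι₁ V Γ) 1)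
    (h₀ : ω₁ ∈ (pinT hHD hI h₁ h₃ h hA W S μ).Theta V c 0 Γ) (h₁' : ω₂ ∈ (pinT hHD hI h₁ h₃ h hA W S μ).Theta V c 1 Γ) :
    J.wf Γ ω₁ ω₂ ∈ (Submodule.span ℂ ((pinT hHD hI h₁ h₃ h hA W S μ).gen12Set V c)).topologicalClosure := by
  rw [J.wf_of_mem Γ h₀ h₁']
  refine (Submodule.span ℂ _).le_topologicalClosure ?_
  exact (quotU V).realise_wedge₂_mem_of_span (J.seesaw Γ)
    (J.rep Γ 0 (Or.inl rfl) ω₁ h₀).choose_spec.choose_spec.2.1 (J.rep Γ 1 (Or.inr rfl) ω₂ h₁').choose_spec.choose_spec.2.1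

/-- **`proj` from (J-rep) + (J-Λ)** at the chosen representatives. -/
theorem wf_proj (Γ : Level V) (ω₁ ω₂ : (picardCMUniverse hHD hI h₁ h₃).CohC ((picardCMUniverse hHD hI h₁ h₃).pms L ι₁ V Γ) 1)
    (h₀ : ω₁ ∈ (pinT hHD hI h₁ h₃ h hA W S μ).Theta V c 0 Γ) (h₁' : ω₂ ∈ (pinT hHD hI h₁ h₃ h hA W S μ).Theta V c 1 Γ) :
    ∃ a : ℂ, a ≠ 0 ∧ ⟪(pinT hHD hI h₁ h₃ h hA W S μ).Λ Γ ω₁ ω₂, J.wf Γ ω₁ ω₂⟫_ℂ =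
      a * ⟪(pinT hHD hI h₁ h₃ h hA W S μ).Λ Γ ω₁ ω₂, (pinT hHD hI h₁ h₃ h hA W S μ).Λ Γ ω₁ ω₂⟫_ℂ := by
  obtain ⟨hcl₁, -, hsat₁, hpull₁⟩ := (J.rep Γ 0 (Or.inl rfl) ω₁ h₀).choose_spec.choose_spec
  obtain ⟨hcl₂, -, hsat₂, hpull₂⟩ := (J.rep Γ 1 (Or.inr rfl) ω₂ h₁').choose_spec.choose_spec
  obtain ⟨a, p, ha, hΛ, hp⟩ := J.proj Γ _ _ _ _ hsat₁ hsat₂ hpull₁ hpull₂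
  rw [hcl₁, hcl₂] at hΛ
  rw [J.wf_of_mem Γ h₀ h₁']
  exact ⟨a⁻¹, inv_ne_zero ha, ThetaModel.inner_eq_mul_inner_self_of_eq_smul ha hΛ hp⟩

/-- **THE SPAN BRIDGE AT THE PIN from the junction hypotheses.** -/
def spanBridge : (pinT hHD hI h₁ h₃ h hA W S μ).Gen12SpanBridge V c where
  wf := J.wf
  wf_mem := J.wf_mem
  proj := J.wf_proj

/-- **C5′ at the pin from the junction hypotheses.** -/
theorem gen12MeetAt (J : Gen12Junctions hHD hI h₁ h₃ h hA W S μ V c hV) :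
    (pinT hHD hI h₁ h₃ h hA W S μ).Gen12MeetAt V c :=
  (pinT hHD hI h₁ h₃ h hA W S μ).gen12MeetAt_of_spanBridge J.spanBridge


-- port_pkg: scope closed for this part
end Gen12Junctions
end Model
end HodgeCM
end
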